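import Summits.AtomisticToContinuum.FouriersLaw.Theorems.BondHeatUncertaintyBoundedResponseBathHeatLateTailA
import HarnessLib

/-!
# BondHeatUncertainty / BoundedResponse — «LateTail»: the Ohmic floor is BLIND TO THE LIGHT CONE (lens-1 gen 109) — part 2 of 2 (sequel of `…BondHeatUncertaintyBoundedResponseBathHeatLateTailA`)

Split for the 400-line cap by the landing lane (hand-2 g40); the module docstring of part 1 (`…BondHeatUncertaintyBoundedResponseBathHeatLateTailA`) describes the whole node.  Same namespace; all FQNs unchanged.
0 sorry; standard axioms.
-/

noncomputable section
open MeasureTheory ProbabilityTheory Filter Topology Set Function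
open scoped NNReal ENNReal
open Literature.MathematicalPhysics.KineticTheory.HeatConduction
open Literature.MathematicalPhysics.KineticTheory OscillatorChain
open Literature.Probability.Process
open Summit.AtomisticToContinuum.FouriersLaw.Theorems.SubdiffusiveBondHeat
open Summit.AtomisticToContinuum.FouriersLaw.Theorems.SubdiffusiveBondHeat.EscapeGrading

namespace Summit.AtomisticToContinuum.FouriersLaw.Theorems.BoundedResponse.HeatSpreading

open Summit.AtomisticToContinuum.FouriersLaw.Theses.BondHeatUncertainty (BoundedResponse SubdiffusiveBondHeat)

/-! ## §3 The late negative mass and the pointwise late floors (incl. the ECHO-TOLERANT family) -/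

/-- **Late negative mass `𝔐_N(s,t) := ∫_{(s,∞)} min(r,t)·K_N(r)⁻ dr`** (`x⁻ = max(−x,0)`). [formal bookkeeping] -/
def lateNegMass (ω₂ lam β γ T : ℝ) (N : ℕ) (s t : ℝ) : ℝ :=
  ∫ r in Ioi s, min r t * max (-(bathKinCorr ω₂ lam β γ T N r)) 0

/-- **`LateNegMass a`** — `∀ c > 0 ∃ C N₀ ∀ N ≥ N₀, γ²·𝔐_N(aN, cN²) ≤ C·N`: the `min(r,cN²)`-weighted NEGATIVE mass of the boundary kernel PAST
THE LIGHT CONE is at most Ohmic.  The weakest one-sided supplier of `LateTailFloor a 1 1` (`lateTailFloor_one_of_lateNegMass`); implied by every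
admissible pointwise late floor.  Why it might fail: undamped quasi-ballistic echoes with negative lobes of depth `≍ 1/N` at EVERY traversal `r = 2kN/v`
up to the Thouless time (`Σ_{k ≤ cN} kN·(1/N) ≍ N²`) — a near-integrable regime, where (S) fails too.  Tag: UNDECIDED · phonon-TRUE · INCOMPARABLE
with 11071 · INSTRUMENTABLE (NEGMASS-109). [route statement · this cell; NOT a literature fact] -/
def LateNegMass (a : ℝ) : Prop :=
  ∀ ω₂ lam β γ : ℝ, 0 < ω₂ → 0 < lam → 0 < β → 0 < γ → ∀ T : ℝ, 0 < T → ∀ c : ℝ, 0 < c →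
    ∃ C : ℝ, ∃ N₀ : ℕ, ∀ N : ℕ, N₀ ≤ N →
      γ ^ 2 * lateNegMass ω₂ lam β γ T N (a * N) (c * (N : ℝ) ^ 2) ≤ C * N

/-- **`LateKernelFloor a p α`** — the pointwise late floor `∃ A N₀ ∀ N ≥ N₀ ∀ r ≥ aN, K_N(r) ≥ −A·N^p·r^{−α}` (the (BKᶠ_{p,α}) of NODE 107 asked
only past the light cone).  Admissible for the Ohmic grade iff `(α > 2 ∧ p ≤ α − 1) ∨ (1 < α < 2 ∧ p ≤ 2α − 3)` (∨ `α = 2 ∧ p < 1`, not typed);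
the ECHO-TOLERANT members are `(α − 1, α)`, `α > 2`: `K_N(r) ≥ −(A/N)(N/r)^α`.  Tag: UNDECIDED · phonon-TRUE · INSTRUMENTABLE (ECHO-109).
[route statement · this cell; NOT a literature fact] -/
def LateKernelFloor (a p α : ℝ) : Prop :=
  ∀ ω₂ lam β γ : ℝ, 0 < ω₂ → 0 < lam → 0 < β → 0 < γ → ∀ T : ℝ, 0 < T →
    ∃ A : ℝ, ∃ N₀ : ℕ, ∀ N : ℕ, N₀ ≤ N → ∀ r : ℝ, a * N ≤ r →
      -(A * (N : ℝ) ^ p * r ^ (-α)) ≤ bathKinCorr ω₂ lam β γ T N r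

/-- **`LateVarChannelFloor a p α`** — NODE 108's variance channel `VC_N(r) = Cov_{μ_T}(p₀(0)², Var_z p₀(r))` floored past the light cone only:
`∀ N ≥ N₀ ∀ r ≥ aN, VC_N(r) ≥ −A·N^p·r^{−α}`.  The critic's 1a «LocalEquilibriumChannel»: at lags `r ≳ N` the conditional variance of the boundary
momentum is the local kinetic temperature of site `0`, and the floor says the initial boundary heat never forecasts a COLDER boundary later by more than
the echo-tolerant allowance — the heat-RETURN correlation.  Tag: UNDECIDED · phonon-TRUE (`VC ≡ 0`) · IDEA-NEEDED · INSTRUMENTABLE (WICK/FORK-108 at lags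
`≥ aN`). [route statement · this cell; NOT a literature fact] -/
def LateVarChannelFloor (a p α : ℝ) : Prop :=
  ∀ ω₂ lam β γ : ℝ, 0 < ω₂ → 0 < lam → 0 < β → 0 < γ → ∀ T : ℝ, 0 < T →
    ∃ A : ℝ, ∃ N₀ : ℕ, ∀ N : ℕ, N₀ ≤ N → ∀ r : ℝ, a * N ≤ r →
      -(A * (N : ℝ) ^ p * r ^ (-α)) ≤ bathVarChannel ω₂ lam β γ T N r

/-- **`LateCommonPastFloor a p α`** — NODE 108's common-past channel `CP_N(r) = Cov_{μ_T}(p₀², m_r²)` floored past the light cone only.  Here live the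
ECHOES (returning sound pulses make `m_r` large again at `r = 2kN/v`); the echo-tolerant exponents are designed for it.  Tag: UNDECIDED · phonon-TRUE
(`CP = 2c² ≥ 0`) · INSTRUMENTABLE. [route statement · this cell; NOT a literature fact] -/
def LateCommonPastFloor (a p α : ℝ) : Prop :=
  ∀ ω₂ lam β γ : ℝ, 0 < ω₂ → 0 < lam → 0 < β → 0 < γ → ∀ T : ℝ, 0 < T →
    ∃ A : ℝ, ∃ N₀ : ℕ, ∀ N : ℕ, N₀ ≤ N → ∀ r : ℝ, a * N ≤ r →
      -(A * (N : ℝ) ^ p * r ^ (-α)) ≤ bathCommonPast ω₂ lam β γ T N r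

section Late

variable {ω₂ lam β γ : ℝ} (hω : 0 < ω₂) (hl : 0 < lam) (hβ : 0 < β) (hγ : 0 < γ) {T : ℝ} (hT : 0 < T)
include hω hl hβ hγ hT

/-- `min(r,t)·K_N⁻` is integrable on `(s,∞)` (`s,t ≥ 0`; `K_N⁻ ≤ |K_N| ∈ L¹`). [folklore] -/
theorem integrableOn_min_mul_negPart {N : ℕ} (hN : 0 < N) {s t : ℝ} (hs : 0 ≤ s) (ht : 0 ≤ t) :
    IntegrableOn (fun r : ℝ => min r t * max (-(bathKinCorr ω₂ lam β γ T N r)) 0) (Ioi s) := by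
  obtain ⟨hKc, -, hL1⟩ := bathKinCorr_basics hω hl hβ hγ hT hN
  have hL1s : IntegrableOn (bathKinCorr ω₂ lam β γ T N) (Ioi s) := hL1.mono_set (Ioi_subset_Ioi hs)
  refine Integrable.mono' (hL1s.abs.const_mul t)
    ((continuous_id.min continuous_const).mul (hKc.neg.max continuous_const)).aestronglyMeasurable ?_
  filter_upwards [ae_restrict_mem measurableSet_Ioi] with r hr
  have hr0 : 0 ≤ r := le_trans hs (le_of_lt hr)
  have hm0 : 0 ≤ min r t := le_min hr0 ht
  have hneg : max (-(bathKinCorr ω₂ lam β γ T N r)) 0 ≤ |bathKinCorr ω₂ lam β γ T N r| :=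
    max_le (neg_le_abs _) (abs_nonneg _)
  rw [Real.norm_eq_abs, abs_mul, abs_of_nonneg hm0, abs_of_nonneg (le_max_right _ _)]
  calc min r t * max (-(bathKinCorr ω₂ lam β γ T N r)) 0 ≤ t * |bathKinCorr ω₂ lam β γ T N r| :=
        mul_le_mul (min_le_right _ _) hneg (le_max_right _ _) ht
    _ = t * |bathKinCorr ω₂ lam β γ T N r| := rfl

/-- ★ **Late floor from late negative mass, one `N` at a time**: for `N ≥ 1`, `0 ≤ s`, `2s ≤ t`:
`B^late_N(s,t) ≥ −γ²·𝔐_N(s,t)` (`ℓ = 0` on `(0,s]`, `0 ≤ ℓ ≤ min(·,t)` and `K_N ≥ −K_N⁻` beyond). [this cell] -/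
theorem bathTailLate_ge_neg_lateNegMass {N : ℕ} (hN : 0 < N) {s t : ℝ} (hs : 0 ≤ s) (hst : 2 * s ≤ t) :
    -(γ ^ 2 * lateNegMass ω₂ lam β γ T N s t) ≤ bathTailLate ω₂ lam β γ T N s t := by
  have ht : 0 ≤ t := by linarith
  rw [bathTailLate_eq_integral hω hl hβ hγ hT hN hs ht]
  have hI := integrableOn_lateWeight_mul_bathKinCorr hω hl hβ hγ hT hN hs ht
  -- split `(0,∞) = (0,s] ∪ (s,∞)`; the first piece vanishes
  have hsplit : ∫ r in Ioi (0:ℝ), lateWeight s t r * bathKinCorr ω₂ lam β γ T N r =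
      (∫ r in Ioc (0:ℝ) s, lateWeight s t r * bathKinCorr ω₂ lam β γ T N r) +
        ∫ r in Ioi s, lateWeight s t r * bathKinCorr ω₂ lam β γ T N r := by
    rw [← Ioc_union_Ioi_eq_Ioi hs]
    exact setIntegral_union Ioc_disjoint_Ioi_same measurableSet_Ioi (hI.mono_set Ioc_subset_Ioi_self)
      (hI.mono_set (Ioi_subset_Ioi hs))
  have hzero : ∫ r in Ioc (0:ℝ) s, lateWeight s t r * bathKinCorr ω₂ lam β γ T N r = 0 := by
    have h0 : ∫ r in Ioc (0:ℝ) s, lateWeight s t r * bathKinCorr ω₂ lam β γ T N r = ∫ r in Ioc (0:ℝ) s, (0:ℝ) :=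
      setIntegral_congr_fun measurableSet_Ioc (fun r hr => by
        show lateWeight s t r * bathKinCorr ω₂ lam β γ T N r = 0
        rw [lateWeight_eq_zero hs hr.2 (le_trans hr.2 (by linarith)), zero_mul])
    rw [h0, integral_zero]
  have hmono : ∫ r in Ioi s, -(min r t * max (-(bathKinCorr ω₂ lam β γ T N r)) 0) ≤
      ∫ r in Ioi s, lateWeight s t r * bathKinCorr ω₂ lam β γ T N r := by
    refine setIntegral_mono_on (integrableOn_min_mul_negPart hω hl hβ hγ hT hN hs ht).neg (hI.mono_set (Ioi_subset_Ioi hs))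
      measurableSet_Ioi (fun r hr => ?_)
    have hr0 : 0 ≤ r := le_trans hs (le_of_lt hr)
    have hℓ0 : 0 ≤ lateWeight s t r := lateWeight_nonneg hs hst hr0
    have hℓ1 : lateWeight s t r ≤ min r t := lateWeight_le_min hs hr0
    have hK : -(max (-(bathKinCorr ω₂ lam β γ T N r)) 0) ≤ bathKinCorr ω₂ lam β γ T N r := by
      have := le_max_left (-(bathKinCorr ω₂ lam β γ T N r)) 0
      linarith
    have hM : 0 ≤ max (-(bathKinCorr ω₂ lam β γ T N r)) 0 := le_max_right _ _
    -- `ℓ·K ≥ ℓ·(−K⁻) ≥ min(r,t)·(−K⁻)`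
    have h1 : lateWeight s t r * -(max (-(bathKinCorr ω₂ lam β γ T N r)) 0) ≤
        lateWeight s t r * bathKinCorr ω₂ lam β γ T N r := mul_le_mul_of_nonneg_left hK hℓ0
    nlinarith [mul_le_mul_of_nonneg_right hℓ1 hM]
  rw [integral_neg] at hmono
  unfold lateNegMass
  rw [hsplit, hzero, zero_add]
  nlinarith [sq_nonneg γ]

end Late

/-- ★ **`LateNegMass a ⟹ LateTailFloor a 1 1`** (`a > 0`; eventually `2aN ≤ cN²`). [this cell] -/
theorem lateTailFloor_one_of_lateNegMass {a : ℝ} (ha : 0 < a) (hM : LateNegMass a) : LateTailFloor a 1 1 := by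
  intro ω₂ lam β γ hω hl hβ hγ T hT c hc
  obtain ⟨C, N₀, hC⟩ := hM ω₂ lam β γ hω hl hβ hγ T hT c hc
  refine ⟨C, max N₀ (max 1 (Nat.ceil (2 * a / c))), fun N hN => ?_⟩
  have hNN₀ : N₀ ≤ N := le_trans (le_max_left _ _) hN
  have hN1 : 1 ≤ N := le_trans (le_max_left _ _) (le_trans (le_max_right _ _) hN)
  have hNc : Nat.ceil (2 * a / c) ≤ N := le_trans (le_max_right _ _) (le_trans (le_max_right _ _) hN)
  have hNpos : (0:ℝ) < N := by exact_mod_cast hN1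
  have h2a : 2 * a / c ≤ (N : ℝ) := le_trans (Nat.le_ceil _) (by exact_mod_cast hNc)
  have hst : 2 * (a * (N : ℝ)) ≤ c * (N : ℝ) ^ 2 := by
    rw [div_le_iff₀ hc] at h2a
    nlinarith
  simp only [Real.rpow_one]
  have h := bathTailLate_ge_neg_lateNegMass hω hl hβ hγ hT hN1 (by positivity : 0 ≤ a * (N : ℝ)) hst
  linarith [hC N hNN₀]

/-- ★★ **(S) ∧ `LateNegMass a` ⟹ 11071** (`a > 0`). [this cell] -/
theorem boundedResponse_of_subdiffusiveBondHeat_lateNegMass {a : ℝ} (ha : 0 < a) (hS : SubdiffusiveBondHeat) (hM : LateNegMass a) :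
    BoundedResponse :=
  boundedResponse_of_subdiffusiveBondHeat_lateTailFloor ha.le le_rfl hS (lateTailFloor_one_of_lateNegMass ha hM)

/-- Pointwise: a late floor bounds the negative part, `K_N(r)⁻ ≤ max(A,0)·N^p·r^{−α}`. [folklore] -/
theorem negPart_le_of_floor {ω₂ lam β γ T : ℝ} {N : ℕ} {A p α r : ℝ} (hr : 0 ≤ r)
    (h : -(A * (N : ℝ) ^ p * r ^ (-α)) ≤ bathKinCorr ω₂ lam β γ T N r) :
    max (-(bathKinCorr ω₂ lam β γ T N r)) 0 ≤ max A 0 * (N : ℝ) ^ p * r ^ (-α) := by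
  have hw : 0 ≤ (N : ℝ) ^ p * r ^ (-α) := mul_nonneg (Real.rpow_nonneg (Nat.cast_nonneg N) _) (Real.rpow_nonneg hr _)
  refine max_le ?_ (by have := mul_nonneg (le_max_right A 0) hw; nlinarith)
  have hA : A * ((N : ℝ) ^ p * r ^ (-α)) ≤ max A 0 * ((N : ℝ) ^ p * r ^ (-α)) := mul_le_mul_of_nonneg_right (le_max_left _ _) hw
  nlinarith

/-- ★ **ECHO-TOLERANT SUPPLIERS: `LateKernelFloor a p α ⟹ LateNegMass a` for `α > 2`, `p ≤ α − 1`** (`a > 0`):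
`𝔐_N(aN,cN²) ≤ A⁺N^p ∫_{(aN,∞)} r^{1−α} dr = A⁺a^{2−α}/(α−2)·N^{p+2−α} ≤ C·N`.  In particular `K_N(r) ≥ −(A/N)(N/r)^α` on `r ≥ aN` suffices, for
any `α > 2`. [this cell] -/
theorem lateNegMass_of_lateKernelFloor_of_two_lt {a p α : ℝ} (ha : 0 < a) (hα : 2 < α) (hp : p ≤ α - 1)
    (hK : LateKernelFloor a p α) : LateNegMass a := by
  intro ω₂ lam β γ hω hl hβ hγ T hT c hc
  obtain ⟨A, N₀, hA⟩ := hK ω₂ lam β γ hω hl hβ hγ T hT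
  set A' : ℝ := max A 0 with hA'def
  have hA'0 : 0 ≤ A' := le_max_right _ _
  refine ⟨γ ^ 2 * (A' * (a ^ (2 - α) / (α - 2))), max N₀ 1, fun N hN => ?_⟩
  have hNN₀ : N₀ ≤ N := le_trans (le_max_left _ _) hN
  have hN1 : 1 ≤ N := le_trans (le_max_right _ _) hN
  have hNpos : (0:ℝ) < N := by exact_mod_cast hN1
  have hN1' : (1:ℝ) ≤ N := by exact_mod_cast hN1
  have haN : 0 < a * (N : ℝ) := mul_pos ha hNpos
  have ht : 0 ≤ c * (N : ℝ) ^ 2 := by positivity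
  -- pointwise on `(aN, ∞)`: `min(r,t) K⁻ ≤ A' N^p r^{1−α}`
  have hrpow : IntegrableOn (fun r : ℝ => r ^ (1 - α)) (Ioi (a * N)) := integrableOn_Ioi_rpow_of_lt (by linarith) haN
  have hdom : IntegrableOn (fun r : ℝ => A' * (N : ℝ) ^ p * r ^ (1 - α)) (Ioi (a * N)) := hrpow.const_mul _
  have hmono : ∫ r in Ioi (a * (N : ℝ)), min r (c * (N : ℝ) ^ 2) * max (-(bathKinCorr ω₂ lam β γ T N r)) 0 ≤
      ∫ r in Ioi (a * (N : ℝ)), A' * (N : ℝ) ^ p * r ^ (1 - α) := by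
    refine setIntegral_mono_on (integrableOn_min_mul_negPart hω hl hβ hγ hT (by omega) haN.le ht) hdom measurableSet_Ioi
      (fun r hrI => ?_)
    have hr : 0 < r := lt_trans haN hrI
    have hneg := negPart_le_of_floor hr.le (hA N hNN₀ r hrI.le)
    have hm : min r (c * (N : ℝ) ^ 2) ≤ r := min_le_left _ _
    have hm0 : 0 ≤ min r (c * (N : ℝ) ^ 2) := le_min hr.le ht
    have hw : 0 ≤ A' * (N : ℝ) ^ p * r ^ (-α) := by
      have := negPart_le_of_floor hr.le (hA N hNN₀ r hrI.le)
      exact le_trans (le_max_right _ _) this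
    have hsplit : r ^ (1 - α) = r * r ^ (-α) := by
      rw [show (1:ℝ) - α = 1 + -α by ring, Real.rpow_add hr, Real.rpow_one]
    calc min r (c * (N : ℝ) ^ 2) * max (-(bathKinCorr ω₂ lam β γ T N r)) 0
        ≤ min r (c * (N : ℝ) ^ 2) * (A' * (N : ℝ) ^ p * r ^ (-α)) := mul_le_mul_of_nonneg_left hneg hm0
      _ ≤ r * (A' * (N : ℝ) ^ p * r ^ (-α)) := mul_le_mul_of_nonneg_right hm hw
      _ = A' * (N : ℝ) ^ p * r ^ (1 - α) := by rw [hsplit]; ring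
  -- evaluate `∫_{(aN,∞)} r^{1−α} = (aN)^{2−α}/(α−2)`
  have hval : ∫ r in Ioi (a * (N : ℝ)), r ^ (1 - α) = (a * (N : ℝ)) ^ (2 - α) / (α - 2) := by
    rw [integral_Ioi_rpow_of_lt (by linarith) haN, show (1:ℝ) - α + 1 = 2 - α by ring, neg_div, ← div_neg, neg_sub]
  have hval' : ∫ r in Ioi (a * (N : ℝ)), A' * (N : ℝ) ^ p * r ^ (1 - α) =
      A' * (N : ℝ) ^ p * ((a * (N : ℝ)) ^ (2 - α) / (α - 2)) := by
    rw [integral_const_mul, hval]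
  -- `N^p (aN)^{2−α} = a^{2−α} N^{p+2−α} ≤ a^{2−α} N`
  have hexp : (N : ℝ) ^ p * (a * (N : ℝ)) ^ (2 - α) ≤ a ^ (2 - α) * N := by
    rw [Real.mul_rpow ha.le hNpos.le, mul_left_comm, ← Real.rpow_add hNpos]
    have : (N : ℝ) ^ (p + (2 - α)) ≤ (N : ℝ) ^ (1:ℝ) := Real.rpow_le_rpow_of_exponent_le hN1' (by linarith)
    rw [Real.rpow_one] at this
    exact mul_le_mul_of_nonneg_left this (Real.rpow_nonneg ha.le _)
  have hα2 : 0 < α - 2 := by linarith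
  unfold lateNegMass
  calc γ ^ 2 * ∫ r in Ioi (a * (N : ℝ)), min r (c * (N : ℝ) ^ 2) * max (-(bathKinCorr ω₂ lam β γ T N r)) 0
      ≤ γ ^ 2 * (A' * (N : ℝ) ^ p * ((a * (N : ℝ)) ^ (2 - α) / (α - 2))) := by
        rw [← hval']; exact mul_le_mul_of_nonneg_left hmono (sq_nonneg γ)
    _ = γ ^ 2 * (A' / (α - 2)) * ((N : ℝ) ^ p * (a * (N : ℝ)) ^ (2 - α)) := by ring
    _ ≤ γ ^ 2 * (A' / (α - 2)) * (a ^ (2 - α) * N) :=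
        mul_le_mul_of_nonneg_left hexp (by positivity)
    _ = γ ^ 2 * (A' * (a ^ (2 - α) / (α - 2))) * N := by ring

/-- ★ **`LateKernelFloor a p α ⟹ LateNegMass a` for `1 < α < 2`, `p ≤ 2α − 3`** (`a > 0`) — the door of record's region, now asked only past the
light cone: `𝔐_N ≤ A⁺N^p∫_{(0,∞)} min(r,cN²) r^{−α} = A⁺c_α c^{2−α}·N^{p+4−2α} ≤ C·N`. [this cell] -/
theorem lateNegMass_of_lateKernelFloor_of_lt_two {a p α : ℝ} (ha : 0 < a) (hα₁ : 1 < α) (hα₂ : α < 2) (hp : p ≤ 2 * α - 3)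
    (hK : LateKernelFloor a p α) : LateNegMass a := by
  intro ω₂ lam β γ hω hl hβ hγ T hT c hc
  obtain ⟨A, N₀, hA⟩ := hK ω₂ lam β γ hω hl hβ hγ T hT
  set A' : ℝ := max A 0 with hA'def
  have hA'0 : 0 ≤ A' := le_max_right _ _
  set cα : ℝ := ∫ u in Ioi (0:ℝ), min u 1 * u ^ (-α) with hcα
  have hcα0 : 0 ≤ cα := setIntegral_nonneg measurableSet_Ioi fun u hu =>
    mul_nonneg (le_min (le_of_lt hu) zero_le_one) (Real.rpow_nonneg (le_of_lt hu) _)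
  refine ⟨γ ^ 2 * (A' * (c ^ (2 - α) * cα)), max N₀ 1, fun N hN => ?_⟩
  have hNN₀ : N₀ ≤ N := le_trans (le_max_left _ _) hN
  have hN1 : 1 ≤ N := le_trans (le_max_right _ _) hN
  have hNpos : (0:ℝ) < N := by exact_mod_cast hN1
  have hN1' : (1:ℝ) ≤ N := by exact_mod_cast hN1
  have haN : 0 < a * (N : ℝ) := mul_pos ha hNpos
  have ht : 0 < c * (N : ℝ) ^ 2 := by positivity
  have hLi := integrableOn_min_mul_rpow hα₁ hα₂ ht
  have hdom : IntegrableOn (fun r : ℝ => A' * (N : ℝ) ^ p * (min r (c * (N : ℝ) ^ 2) * r ^ (-α))) (Ioi (a * N)) :=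
    (hLi.mono_set (Ioi_subset_Ioi haN.le)).const_mul _
  have hmono : ∫ r in Ioi (a * (N : ℝ)), min r (c * (N : ℝ) ^ 2) * max (-(bathKinCorr ω₂ lam β γ T N r)) 0 ≤
      ∫ r in Ioi (a * (N : ℝ)), A' * (N : ℝ) ^ p * (min r (c * (N : ℝ) ^ 2) * r ^ (-α)) := by
    refine setIntegral_mono_on (integrableOn_min_mul_negPart hω hl hβ hγ hT (by omega) haN.le ht.le) hdom measurableSet_Ioi
      (fun r hrI => ?_)
    have hr : 0 < r := lt_trans haN hrI
    have hneg := negPart_le_of_floor hr.le (hA N hNN₀ r hrI.le)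
    have hm0 : 0 ≤ min r (c * (N : ℝ) ^ 2) := le_min hr.le ht.le
    calc min r (c * (N : ℝ) ^ 2) * max (-(bathKinCorr ω₂ lam β γ T N r)) 0
        ≤ min r (c * (N : ℝ) ^ 2) * (A' * (N : ℝ) ^ p * r ^ (-α)) := mul_le_mul_of_nonneg_left hneg hm0
      _ = A' * (N : ℝ) ^ p * (min r (c * (N : ℝ) ^ 2) * r ^ (-α)) := by ring
  -- enlarge the domain to `(0,∞)` (nonnegative integrand) and scale
  have hwhole : ∫ r in Ioi (a * (N : ℝ)), min r (c * (N : ℝ) ^ 2) * r ^ (-α) ≤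
      ∫ r in Ioi (0:ℝ), min r (c * (N : ℝ) ^ 2) * r ^ (-α) :=
    setIntegral_mono_set hLi (ae_restrict_of_forall_mem measurableSet_Ioi fun r hr =>
      mul_nonneg (le_min (le_of_lt hr) ht.le) (Real.rpow_nonneg (le_of_lt hr) _)) (Ioi_subset_Ioi haN.le).eventuallyLE
  have hscale := integral_min_mul_rpow_eq (α := α) ht
  have hexp : (N : ℝ) ^ p * (c * (N : ℝ) ^ 2) ^ (2 - α) ≤ c ^ (2 - α) * N := by
    rw [Real.mul_rpow hc.le (by positivity), ← Real.rpow_natCast (N : ℝ) 2, ← Real.rpow_mul hNpos.le, mul_left_comm,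
      ← Real.rpow_add hNpos]
    have : (N : ℝ) ^ (p + (2:ℕ) * (2 - α)) ≤ (N : ℝ) ^ (1:ℝ) :=
      Real.rpow_le_rpow_of_exponent_le hN1' (by push_cast; linarith)
    rw [Real.rpow_one] at this
    exact mul_le_mul_of_nonneg_left this (Real.rpow_nonneg hc.le _)
  unfold lateNegMass
  calc γ ^ 2 * ∫ r in Ioi (a * (N : ℝ)), min r (c * (N : ℝ) ^ 2) * max (-(bathKinCorr ω₂ lam β γ T N r)) 0
      ≤ γ ^ 2 * (A' * (N : ℝ) ^ p * ∫ r in Ioi (0:ℝ), min r (c * (N : ℝ) ^ 2) * r ^ (-α)) := by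
        refine mul_le_mul_of_nonneg_left (hmono.trans ?_) (sq_nonneg γ)
        rw [integral_const_mul]
        exact mul_le_mul_of_nonneg_left hwhole (by positivity)
    _ = γ ^ 2 * A' * ((N : ℝ) ^ p * (c * (N : ℝ) ^ 2) ^ (2 - α)) * cα := by rw [hscale]; ring
    _ ≤ γ ^ 2 * A' * (c ^ (2 - α) * N) * cα :=
        mul_le_mul_of_nonneg_right (mul_le_mul_of_nonneg_left hexp (by positivity)) hcα0
    _ = γ ^ 2 * (A' * (c ^ (2 - α) * cα)) * N := by ring

/-- **The door of record factors through the light cone**: `BathKernelFloor p α ⟹ LateKernelFloor a p α` for every `a > 0` (eventually `aN ≥ r₀`).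
[formal bookkeeping] -/
theorem lateKernelFloor_of_bathKernelFloor {a p α : ℝ} (ha : 0 < a) (hK : BathKernelFloor p α) : LateKernelFloor a p α := by
  intro ω₂ lam β γ hω hl hβ hγ T hT
  obtain ⟨A, r₀, hr₀, N₀, hA⟩ := hK ω₂ lam β γ hω hl hβ hγ T hT
  refine ⟨A, max N₀ (Nat.ceil (r₀ / a)), fun N hN r hr => hA N (le_trans (le_max_left _ _) hN) r ?_⟩
  have hNc : (Nat.ceil (r₀ / a) : ℝ) ≤ N := by exact_mod_cast le_trans (le_max_right _ _) hN
  have h1 : r₀ / a ≤ N := le_trans (Nat.le_ceil _) hNc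
  rw [div_le_iff₀ ha] at h1
  linarith

/-- ★ **Late channel floors ⟹ late kernel floor** (NODE 108's exact split `K_N = CP_N + VC_N`, constants add). [this cell] -/
theorem lateKernelFloor_of_lateChannelFloors {a p α : ℝ} (hP : LateCommonPastFloor a p α) (hV : LateVarChannelFloor a p α) :
    LateKernelFloor a p α := by
  intro ω₂ lam β γ hω hl hβ hγ T hT
  obtain ⟨A, N₀, hA⟩ := hP ω₂ lam β γ hω hl hβ hγ T hT
  obtain ⟨A', N₀', hA'⟩ := hV ω₂ lam β γ hω hl hβ hγ T hT
  refine ⟨A + A', max (max N₀ N₀') 1, fun N hN r hr => ?_⟩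
  have hN1 : 0 < N := lt_of_lt_of_le Nat.one_pos (le_trans (le_max_right _ _) hN)
  have h1 := hA N (le_trans (le_trans (le_max_left _ _) (le_max_left _ _)) hN) r hr
  have h2 := hA' N (le_trans (le_trans (le_max_right _ _) (le_max_left _ _)) hN) r hr
  rw [bathKinCorr_eq_commonPast_add_varChannel hω hl hβ hγ hT hN1 r]
  nlinarith

/-- NODE 108's channel floors imply their late restrictions (`a > 0`). [formal bookkeeping] -/
theorem lateChannelFloors_of_channelFloors {a p α : ℝ} (ha : 0 < a) (hP : BathCommonPastFloor p α) (hV : BathVarChannelFloor p α) :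
    LateCommonPastFloor a p α ∧ LateVarChannelFloor a p α := by
  constructor
  · intro ω₂ lam β γ hω hl hβ hγ T hT
    obtain ⟨A, t₀, ht₀, N₀, hA⟩ := hP ω₂ lam β γ hω hl hβ hγ T hT
    refine ⟨A, max N₀ (Nat.ceil (t₀ / a)), fun N hN r hr => hA N (le_trans (le_max_left _ _) hN) r ?_⟩
    have hNc : (Nat.ceil (t₀ / a) : ℝ) ≤ N := by exact_mod_cast le_trans (le_max_right _ _) hN
    have h1 : t₀ / a ≤ N := le_trans (Nat.le_ceil _) hNc
    rw [div_le_iff₀ ha] at h1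
    linarith
  · intro ω₂ lam β γ hω hl hβ hγ T hT
    obtain ⟨A, t₀, ht₀, N₀, hA⟩ := hV ω₂ lam β γ hω hl hβ hγ T hT
    refine ⟨A, max N₀ (Nat.ceil (t₀ / a)), fun N hN r hr => hA N (le_trans (le_max_left _ _) hN) r ?_⟩
    have hNc : (Nat.ceil (t₀ / a) : ℝ) ≤ N := by exact_mod_cast le_trans (le_max_right _ _) hN
    have h1 : t₀ / a ≤ N := le_trans (Nat.le_ceil _) hNc
    rw [div_le_iff₀ ha] at h1
    linarith

/-! ## §4 Doors -/

/-- ★★ **(S) ∧ echo-tolerant late kernel floor ⟹ 11071**: `K_N(r) ≥ −A·N^p·r^{−α}` on `r ≥ aN` with `α > 2`, `p ≤ α − 1` (e.g. `−(A/N)(N/r)^α`).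
[this cell] -/
theorem boundedResponse_of_subdiffusiveBondHeat_lateKernelFloor {a p α : ℝ} (ha : 0 < a) (hα : 2 < α) (hp : p ≤ α - 1)
    (hS : SubdiffusiveBondHeat) (hK : LateKernelFloor a p α) : BoundedResponse :=
  boundedResponse_of_subdiffusiveBondHeat_lateNegMass ha hS (lateNegMass_of_lateKernelFloor_of_two_lt ha hα hp hK)

/-- ★★ **(S) ∧ late kernel floor in the door-of-record region ⟹ 11071** (`1 < α < 2`, `p ≤ 2α − 3`, asked only on `r ≥ aN`). [this cell] -/
theorem boundedResponse_of_subdiffusiveBondHeat_lateKernelFloor' {a p α : ℝ} (ha : 0 < a) (hα₁ : 1 < α) (hα₂ : α < 2)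
    (hp : p ≤ 2 * α - 3) (hS : SubdiffusiveBondHeat) (hK : LateKernelFloor a p α) : BoundedResponse :=
  boundedResponse_of_subdiffusiveBondHeat_lateNegMass ha hS (lateNegMass_of_lateKernelFloor_of_lt_two ha hα₁ hα₂ hp hK)

/-- ★★ **(S) ∧ (late CPᶠ) ∧ (late VCᶠ = «LocalEquilibriumChannel») ⟹ 11071**, echo-tolerant exponents (`α > 2`, `p ≤ α − 1`). [this cell] -/
theorem boundedResponse_of_subdiffusiveBondHeat_lateChannelFloors {a p α : ℝ} (ha : 0 < a) (hα : 2 < α) (hp : p ≤ α - 1)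
    (hS : SubdiffusiveBondHeat) (hP : LateCommonPastFloor a p α) (hV : LateVarChannelFloor a p α) : BoundedResponse :=
  boundedResponse_of_subdiffusiveBondHeat_lateKernelFloor ha hα hp hS (lateKernelFloor_of_lateChannelFloors hP hV)

/-- **The door of record, re-derived through the light cone**: (S) ∧ (BKᶠ_{0,3/2}) ⟹ 11071 via `LateNegMass 1`. [this cell] -/
theorem boundedResponse_of_subdiffusiveBondHeat_bathKernelFloor_viaLate (hS : SubdiffusiveBondHeat) (hK : BathKernelFloor 0 (3 / 2)) :
    BoundedResponse :=
  boundedResponse_of_subdiffusiveBondHeat_lateKernelFloor' one_pos (by norm_num) (by norm_num) (by norm_num) hS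
    (lateKernelFloor_of_bathKernelFloor one_pos hK)

/-- **LADDER SUMMARY** (the quantitative ladder of this node, all arrows PROVED): for `a > 0`,
`(BK⁺)/(BKᶠ_{0,3/2})/(CPᶠ∧VCᶠ) ⟹ LateKernelFloor ⟹ LateNegMass a ⟹ LateTailFloor a 1 1 ⟺ (BTᶠ_1) ⟸ 11071`, and `(S) ∧ LateTailFloor a 1 1 ⟹ 11071`.
[this cell] -/
theorem lateLadder {a : ℝ} (ha : 0 < a) :
    (BathKernelFloor 0 (3 / 2) → LateNegMass a) ∧
    (∀ α p : ℝ, 2 < α → p ≤ α - 1 → LateKernelFloor a p α → LateNegMass a) ∧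
    (LateNegMass a → LateTailFloor a 1 1) ∧ (LateTailFloor a 1 1 ↔ BathTailFloor 1) ∧
    (BoundedResponse → LateTailFloor a 1 1) ∧ (SubdiffusiveBondHeat → LateTailFloor a 1 1 → BoundedResponse) :=
  ⟨fun hK => lateNegMass_of_lateKernelFloor_of_lt_two ha (by norm_num) (by norm_num) (by norm_num)
      (lateKernelFloor_of_bathKernelFloor ha hK),
   fun α p hα hp hK => lateNegMass_of_lateKernelFloor_of_two_lt ha hα hp hK,
   lateTailFloor_one_of_lateNegMass ha, lateTailFloor_iff_bathTailFloor ha.le le_rfl,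
   lateTailFloor_of_boundedResponse ha.le le_rfl,
   fun hS hL => boundedResponse_of_subdiffusiveBondHeat_lateTailFloor ha.le le_rfl hS hL⟩

end Summit.AtomisticToContinuum.FouriersLaw.Theorems.BoundedResponse.HeatSpreading

end
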